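/-
Copyright (c) 2026 the pub-hodgecm-mathlib formalisation cell (harness21).  Prover seat hodgecm-mathlib-K2E3-p03 (g2), Track B «K2-LIT» ∕ h413, road J ∕ R3 (r)-class (R3g-ram kit):
a GLOBAL element of `L⁺` which is a unit and NOT A NORM at a tamely ramified place (Serre, *Local Fields* V §3; weak approximation, Cassels–Fröhlich II §6).
-/
import Literature.NumberTheory.LocalFields.RamifiedPlaceUnitNorms                 -- ★ (U1) (U2) (U5): the residue-square criterion, a local fixed non-norm unit, `|η − σz·z|_w = 1`
import Literature.NumberTheory.Automorphic.UnitaryGroupInertPlaceHyperbolicBasis  -- ★ `exists_toPlace_eq_of_galAdicCompletionMap_eq` (σ_w-fixed ⇒ comes from `L⁺_v`)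
import Literature.NumberTheory.Automorphic.RamifiedPlaceEisensteinBasis           -- ★ `valued_toPlace_eq_sq_of_ramified` (`|ι_w y|_w = |y|_v²`)
import Literature.NumberTheory.Weil1982.UnitaryFinTopFormRankOneSanitySplit       -- ★ `valued_two_eq_one_of_not_mem` (`2 ∉ v ⇒ |2|_w = 1`)
import HarnessLib

/-!
# A global non-norm unit at a tamely ramified place: some `ξ ∈ L⁺` is a unit of `L_w` with NON-SQUARE residue, hence not a norm from `L_w` (Serre V §3 + weak approximation)

Topic `NumberTheory/LocalFields`; namespace `Literature.NumberTheory.LocalFields.RamifiedPlaceUnitNorms` (continues ★ `RamifiedPlaceUnitNorms`).  THEOREMS ONLY (no definition, no instance, no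
notation, no axiom, no named fact, no `sorry`); kernel lane `--kind proof --supports stmt-HodgeConjecture-24833` (count-neutral).  Cell `pub/hodgecm-mathlib`, crux H413, Track B «K2-LIT»,
road J of ‹S›, letter ‹J3› v2 leaf (J3r) (ramified odd), (r)-class K2E3-p03 (g2): the ramified replacement of ★ R3g kit's `exists_global_uniformizer` ∕ `not_exists_uniformizer_eq_norm` —
at a RAMIFIED place the uniformiser `ϖ_v` of `L⁺_v` MAY be a norm, and the non-trivial class of `L⁺_v^× ∕ N(L_w^×)` (index two) is represented by a UNIT of non-square residue instead
([Serre1979, V §3 Cor. 2]); the block models of the compact sheet and of the dock at a ramified place are normalised by such a global `ξ` (anisotropic plane `⟨1,−ξ⟩`, line `⟨ξ⟩`).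

THE MATHEMATICS.  `w ∣ v` ramified (`e ≠ 1`), `2 ∉ v` (tame).  ★ (U2) gives a LOCAL `σ_w`-fixed unit `η ∈ L_w` of non-square residue; being fixed it is `ι_w(η₀)`, `η₀ ∈ L⁺_v` (★ descent);
`L⁺` is dense in `L⁺_v` (Mathlib `denseRange_algebraMap`), so some `ξ ∈ L⁺` has `|ξ − η₀|_v < 1`, whence `|ξ − η|_w = |ξ − η₀|_v² < 1`: `ξ` is a unit of `L_w` with the SAME residue as
`η`, so non-square; by ★ (U5) `|σ_w u·u − ξ|_w = 1` for every unit `u`, and by ★ (U1) (+ `|t| = 1` for any `t` with `t·σt` a unit) `ξ` is not a norm `t·σ_w t` of any `t ∈ L_w`.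
* **`exists_global_unit_not_norm_of_ramified`** (CM dress: `L ∕ L⁺`, `c` = complex conjugation).
HONEST LABEL: count-neutral; HC_CM is proved only modulo the 7 printed citations (2 remaining: hLiu418 = `stmt-HodgeConjecture-24832`, h413 = `stmt-HodgeConjecture-24833`) until rung 0 closes.

## References
* [Serre1979] J.-P. Serre, *Local Fields*, GTM 67 (1979), Ch. V §3 Prop. 5 and Cor. 2 (norm group of a tamely ramified quadratic extension; index two, residue character).
* [CasselsFrohlichANT1967] J. W. S. Cassels, A. Fröhlich (eds.), *Algebraic Number Theory* (1967), Ch. II §6 (density of `K` in `K_v`), §10.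
-/

set_option autoImplicit false

noncomputable section

open NumberField IsDedekindDomain ValuativeRel
open scoped ValuativeRel
open Literature.NumberTheory.Automorphic Literature.NumberTheory.Automorphic.UnitaryGroup

namespace Literature.NumberTheory.LocalFields.RamifiedPlaceUnitNorms

section CM

variable (L : Type) [Field L] [NumberField L] [IsCMField L] (v : HeightOneSpectrum (𝓞 ↥(maximalRealSubfield L)))
  (w : PlacesOver L v) (hw : IsCMField.complexConj L • w.1 = w.1)

include hw in
/-- **A GLOBAL NON-NORM UNIT AT A TAMELY RAMIFIED PLACE.**  For `w ∣ v` ramified (`e(w|v) ≠ 1`) with `2 ∉ v` there is `ξ ∈ L⁺ ⊂ L` (fixed by complex conjugation) whose image in `L_w` is a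
unit of NON-SQUARE residue; consequently `|σ_w u · u − ξ|_w = 1` for every unit `u` of `L_w` (★ (U5)) and `ξ` is not a norm `t · σ_w t` of any `t ∈ L_w` (★ (U1)).  Local witness ★ (U2)
`exists_fixed_unit_not_norm_of_ramified`, descended to `L⁺_v` (★ `exists_toPlace_eq_of_galAdicCompletionMap_eq`) and approximated from `L⁺` within the unit ball (Mathlib
`denseRange_algebraMap`; `|ι_w y|_w = |y|_v²`). [cite: Serre1979, Ch. V §3 Prop. 5, Cor. 2] [cite: CasselsFrohlichANT1967, Ch. II §6] -/
theorem exists_global_unit_not_norm_of_ramified (he : v.asIdeal.ramificationIdx' w.1.asIdeal ≠ 1) (h2 : (2 : 𝓞 ↥(maximalRealSubfield L)) ∉ v.asIdeal) :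
    ∃ ξ : L, IsCMField.complexConj L ξ = ξ ∧ ∃ hξ1 : Valued.v (algebraMap L (w.1.adicCompletion L) ξ) = 1,
      ¬ IsSquare (IsLocalRing.residue 𝒪[w.1.adicCompletion L] ⟨algebraMap L (w.1.adicCompletion L) ξ, (v_le_one_iff_mem_integer _).1 hξ1.le⟩) ∧
      (∀ u : w.1.adicCompletion L, Valued.v u = 1 →
        Valued.v (galAdicCompletionMap (L := L) (IsCMField.complexConj L) hw u * u - algebraMap L (w.1.adicCompletion L) ξ) = 1) ∧
      ¬ ∃ t : w.1.adicCompletion L, t * galAdicCompletionMap (L := L) (IsCMField.complexConj L) hw t = algebraMap L (w.1.adicCompletion L) ξ := by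
  haveI : Algebra.IsQuadraticExtension ↥(maximalRealSubfield L) L := IsCMField.isQuadraticExtension L
  have hc1 : IsCMField.complexConj L ≠ 1 := IsCMField.complexConj_ne_one L
  have hv2 := Literature.NumberTheory.Weil1982.UnitaryFinTopForm.valued_two_eq_one_of_not_mem L v w h2
  -- (1) a local fixed unit of non-square residue
  obtain ⟨η, hη1, hση, hηns, -⟩ := exists_fixed_unit_not_norm_of_ramified_complexConj L w hw he hv2
  -- (2) it comes from `L⁺_v`
  obtain ⟨η₀, hη₀⟩ := exists_toPlace_eq_of_galAdicCompletionMap_eq (IsCMField.complexConj L) w hc1 hw η hση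
  -- (3) approximate `η₀` by a global `ξ₀ ∈ L⁺` within the unit ball
  have hopen : IsOpen {y : v.adicCompletion ↥(maximalRealSubfield L) | Valued.v (y - η₀) < 1} := by
    have h1 : IsOpen {x : v.adicCompletion ↥(maximalRealSubfield L) | Valued.v x < 1} := by
      have h := Valued.isOpen_ball (v.adicCompletion ↥(maximalRealSubfield L)) 1
      simp only [Valuation.restrict_lt_one_iff] at h
      exact h
    exact h1.preimage (continuous_id.sub continuous_const)
  obtain ⟨ξ₀, hξ₀⟩ := (HeightOneSpectrum.denseRange_algebraMap (K := ↥(maximalRealSubfield L)) v).exists_mem_open hopen ⟨η₀, by simp⟩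
  change Valued.v (algebraMap ↥(maximalRealSubfield L) (v.adicCompletion ↥(maximalRealSubfield L)) ξ₀ - η₀) < 1 at hξ₀
  refine ⟨(ξ₀ : L), IsCMField.complexConj_apply_eq_self L ξ₀, ?_⟩
  -- the image of `ξ₀` at `w` is `ι_w` of its image at `v`
  have hloc : algebraMap L (w.1.adicCompletion L) (ξ₀ : L) = toPlace v w (algebraMap ↥(maximalRealSubfield L) (v.adicCompletion ↥(maximalRealSubfield L)) ξ₀) :=
    (toPlace_coe v w ξ₀).symm
  -- `|ξ − η|_w < 1`
  have hlt : Valued.v (algebraMap L (w.1.adicCompletion L) (ξ₀ : L) - η) < 1 := by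
    rw [hloc, ← hη₀, ← map_sub, valued_toPlace_eq_sq_of_ramified L v w hw he, pow_two]
    exact mul_lt_one_of_nonneg_of_lt_one_left zero_le hξ₀ hξ₀.le
  -- `ξ` is a unit at `w`
  have hξ1 : Valued.v (algebraMap L (w.1.adicCompletion L) (ξ₀ : L)) = 1 := by
    have h := Valuation.map_add_eq_of_lt_left (v := Valued.v) (x := η) (y := algebraMap L (w.1.adicCompletion L) (ξ₀ : L) - η) (by rw [hη1]; exact hlt)
    rwa [add_sub_cancel, hη1] at h
  -- same residue as `η`
  have hres : IsLocalRing.residue 𝒪[w.1.adicCompletion L] ⟨algebraMap L (w.1.adicCompletion L) (ξ₀ : L), (v_le_one_iff_mem_integer _).1 hξ1.le⟩ =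
      IsLocalRing.residue 𝒪[w.1.adicCompletion L] ⟨η, (v_le_one_iff_mem_integer η).1 hη1.le⟩ := by
    rw [← sub_eq_zero, ← map_sub, residue_eq_zero_iff_valuation_lt_one]
    exact (v_lt_one_iff_valuation_lt_one _).1 hlt
  have hξns : ¬ IsSquare (IsLocalRing.residue 𝒪[w.1.adicCompletion L] ⟨algebraMap L (w.1.adicCompletion L) (ξ₀ : L), (v_le_one_iff_mem_integer _).1 hξ1.le⟩) := by
    rw [hres]; exact hηns
  refine ⟨hξ1, hξns, fun u hu => ?_, ?_⟩
  · -- ★ (U5), with the arguments of `−` swapped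
    have h := valued_sub_mul_galAdicCompletionMap_eq_one_of_not_isSquare_residue_complexConj L w hw he hξ1 hξns u hu.le
    rwa [← Valuation.map_neg, neg_sub] at h
  · -- ★ (U1): a norm `t · σt` equal to the unit `ξ` has `|t| = 1`, and then the residue would be a square
    rintro ⟨t, ht⟩
    have ht1 : Valued.v t = 1 := valued_eq_one_of_mul_galAdicCompletionMap_valued_eq_one L (IsCMField.complexConj L) v w hw (by rw [ht]; exact hξ1)
    exact hξns ((exists_mul_galAdicCompletionMap_eq_iff_isSquare_residue_of_ramified_complexConj L w hw he hv2 hξ1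
      (by rw [hloc, galAdicCompletionMap_toPlace])).1 ⟨t, ht1, ht⟩)

end CM

end Literature.NumberTheory.LocalFields.RamifiedPlaceUnitNorms

end
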